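import Literature.NumberTheory.Irrationality.Fischler2017.DistributionOfIrrationalZetaValues
import HarnessLib

/-!
# Fischler 2017: Corollary 1.4 from Theorem 1.3, Corollary 1.8 from Theorem 1.7 (the printed deductions, proved)

Topic `Literature/NumberTheory/Irrationality/Fischler2017`. PROOFS ONLY (no definition, no statement; net debt 0):
`DistributionOfIrrationalZetaValues.lean` types Theorem 1.3, Corollary 1.4, Theorem 1.7 and Corollary 1.8 of
S. Fischler, *Distribution of irrational zeta values*, Bull. Soc. Math. France **145** (2017) 381–409 = arXiv:1310.1685
[Fischler2017Distribution] as four INDEPENDENT named facts. The source deduces the corollaries from the theorems in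
§1 (two lines each); this file proves those deductions on the typed statements — a kernel cross-check of the four
transcriptions against each other (quantifier shapes: `count ε x = ⌊(1−ε)/(1+log 2)·log x⌋₊`, «`d < σ_i ≤ a`»,
the set-builder spans), in the tree's pattern `Zudilin2002.theorem3_of_fischlerZudilin2010`,
`Zlobin2005.corollary1_of_theorem1`:

* `corollary14_of_theorem13 : theorem13 → corollary14` — given `ε > 0` apply Theorem 1.3 with
  `ε′ = min(ε/2, 1/20)`: the `N = ⌊(1−ε′)·log(a/d)/(1+log 2)⌋` odd `σ_i ∈ (d, a]` with `1, ζ(σ_i)` linearly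
  independent over `ℚ` lie in `{ζ(k) : k odd, d ≤ k ≤ a}`, so the span has `finrank ≥ N`
  (`LinearIndependent.fintype_card_le_finrank` in the finite-dimensional span), and
  `N ≥ (1−ε)·log(a/d)/(1+log 2)` once `a/d ≥ C(ε) = max(ε′^{−12/ε′}, 1, exp((1+log 2)/(ε−ε′)))`.
* `corollary18_of_theorem17 : theorem17 → corollary18` — if only finitely many odd `s` made (1.2) irrational, every
  span of Theorem 1.7 would lie in `span_ℚ({1} ∪ {those values})` (a rational value is a rational multiple of `1`),
  of some finite dimension `M`, while Theorem 1.7 at `ε = 1/20`, `a = max((1/20)^{−240}·d, d·e^{t})`,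
  `t = (M+2)(1+log 2)/(19/20)`, gives dimension `≥ ⌊(19/20)·log(a/d)/(1+log 2)⌋ ≥ M + 2`.

HONEST FRAMING (cell pub-zeta5): systematic search; no irrationality claim unless certified. Bookkeeping between
RECORD statements about odd zeta values (the theorems themselves remain named facts); nothing about `ζ(5)`
specifically.
-/

noncomputable section

open Finset

namespace Literature.NumberTheory.Irrationality.Fischler2017

open Literature.NumberTheory.Transcendental (zetaValue)

/-- **Corollary 1.4 follows from Theorem 1.3** (the printed deduction, PROVED): given `ε > 0` apply Theorem 1.3
with `ε′ = min(ε/2, 1/20)`; its `N = ⌊(1−ε′)·log(a/d)/(1+log 2)⌋` odd integers `σ_i ∈ (d, a]` with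
`1, ζ(σ_1), …, ζ(σ_N)` linearly independent over `ℚ` lie in `{ζ(d), ζ(d+2), …, ζ(a)}`, so the dimension of the span is
`≥ N ≥ (1−ε)·log(a/d)/(1+log 2)` as soon as `a/d ≥ max(ε′^{−12/ε′}, exp((1+log 2)/(ε−ε′)))`.
[cite: Fischler2017Distribution, Corollary 1.4 (deduced from Theorem 1.3, §1)] -/
theorem corollary14_of_theorem13 (h13 : theorem13) : corollary14 := by
  intro ε hε
  obtain ⟨ε', hε'pos, hε'le, hε'lt⟩ : ∃ ε' : ℝ, 0 < ε' ∧ ε' ≤ 1 / 20 ∧ ε' < ε :=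
    ⟨min (ε / 2) (1 / 20), lt_min (by linarith) (by norm_num), min_le_right _ _,
      lt_of_le_of_lt (min_le_left _ _) (by linarith)⟩
  have hcpos : 0 < 1 + Real.log 2 := by have := Real.log_pos one_lt_two; linarith
  refine ⟨max (max (ε' ^ (-12 / ε')) 1) (Real.exp ((1 + Real.log 2) / (ε - ε'))), ?_⟩
  intro a d _ _ _ h1 hCle
  have hdpos : (0 : ℝ) < d := by exact_mod_cast (show 0 < d by omega)
  have hx1 : (1 : ℝ) ≤ a / d := le_trans (le_trans (le_max_right _ _) (le_max_left _ _)) hCle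
  have hda : (d : ℝ) ≤ a := by
    have := hx1; rwa [le_div_iff₀ hdpos, one_mul] at this
  have hKle : ε' ^ (-12 / ε') * d ≤ a := by
    have : ε' ^ (-12 / ε') ≤ a / d := le_trans (le_trans (le_max_left _ _) (le_max_left _ _)) hCle
    rwa [le_div_iff₀ hdpos] at this
  obtain ⟨σ, hσ, -, hli⟩ := h13 ε' a d hε'pos hε'le (by exact_mod_cast h1) hda hKle
  -- the spanning set is finite
  set S : Set ℝ := {x : ℝ | ∃ k : ℕ, Odd k ∧ d ≤ k ∧ k ≤ a ∧ x = zetaValue k} with hS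
  have hSfin : S.Finite := by
    refine ((Set.finite_Icc d a).image zetaValue).subset ?_
    rintro x ⟨k, -, hk1, hk2, rfl⟩
    exact ⟨k, ⟨hk1, hk2⟩, rfl⟩
  haveI : Module.Finite ℚ (Submodule.span ℚ S) := Module.Finite.span_of_finite ℚ hSfin
  -- the `N` independent zeta values lie in the span
  have hmem : ∀ i, zetaValue (σ i) ∈ Submodule.span ℚ S := by
    intro i
    obtain ⟨hodd, hdi, hia⟩ := hσ i
    refine Submodule.subset_span ⟨σ i, hodd, ?_, ?_, rfl⟩
    · exact_mod_cast hdi.le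
    · exact_mod_cast hia
  have hli' : LinearIndependent ℚ (fun i => zetaValue (σ i)) := by
    have := hli.comp Fin.succ (Fin.succ_injective _)
    convert this using 1
    funext i
    simp
  have hf : LinearIndependent ℚ (fun i => (⟨zetaValue (σ i), hmem i⟩ : Submodule.span ℚ S)) :=
    LinearIndependent.of_comp (Submodule.span ℚ S).subtype hli'
  have hN : count ε' ((a : ℝ) / d) ≤ Module.finrank ℚ (Submodule.span ℚ S) := by
    simpa using hf.fintype_card_le_finrank
  -- the real inequality
  have hlogC : (1 + Real.log 2) / (ε - ε') ≤ Real.log ((a : ℝ) / d) := by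
    have h := le_trans (le_max_right _ _) hCle
    have := Real.log_le_log (Real.exp_pos _) h
    rwa [Real.log_exp] at this
  have hkey : 1 + Real.log 2 ≤ (ε - ε') * Real.log ((a : ℝ) / d) := by
    rwa [div_le_iff₀ (sub_pos.2 hε'lt), mul_comm] at hlogC
  have h2 : 1 ≤ (ε - ε') * Real.log ((a : ℝ) / d) / (1 + Real.log 2) := by
    rw [le_div_iff₀ hcpos, one_mul]; exact hkey
  have h3 : (1 - ε') / (1 + Real.log 2) * Real.log ((a : ℝ) / d) - 1 - (1 - ε) * Real.log ((a : ℝ) / d) /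
      (1 + Real.log 2) = (ε - ε') * Real.log ((a : ℝ) / d) / (1 + Real.log 2) - 1 := by ring
  have hfloor := Nat.sub_one_lt_floor ((1 - ε') / (1 + Real.log 2) * Real.log ((a : ℝ) / d))
  calc (1 - ε) * Real.log ((a : ℝ) / d) / (1 + Real.log 2)
      ≤ (1 - ε') / (1 + Real.log 2) * Real.log ((a : ℝ) / d) - 1 := by linarith
    _ ≤ (count ε' ((a : ℝ) / d) : ℝ) := by unfold count; exact hfloor.le
    _ ≤ Module.finrank ℚ (Submodule.span ℚ S) := by exact_mod_cast hN

/-- **Corollary 1.8 follows from Theorem 1.7** (the printed deduction, PROVED): if only finitely many odd `s` gave an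
irrational value of (1.2), all the spans of Theorem 1.7 would lie in the `ℚ`-span of `1` and these finitely many
values, of bounded dimension, whereas `[(1−ε)/(1+log 2)·log(a/d)] → ∞` (`ε = 1/20`, `a → ∞`).
[cite: Fischler2017Distribution, Corollary 1.8 (deduced from Theorem 1.7, §1)] -/
theorem corollary18_of_theorem17 (h17 : theorem17) : corollary18 := by
  intro d l hd hl
  by_contra hfin
  rw [Set.not_infinite] at hfin
  -- the finite spanning set `{1} ∪ {(1.2)(s) : s odd, (1.2)(s) irrational}`
  set V : Set ℝ := insert 1 (combination d l '' {s : ℕ | Odd s ∧ Irrational (combination d l s)}) with hV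
  have hVfin : V.Finite := (hfin.image _).insert 1
  haveI : Module.Finite ℚ (Submodule.span ℚ V) := Module.Finite.span_of_finite ℚ hVfin
  have hsub : ∀ a : ℝ, Submodule.span ℚ {x : ℝ | ∃ s : ℕ, Odd s ∧ d ≤ s ∧ (s : ℝ) ≤ a ∧ x = combination d l s} ≤
      Submodule.span ℚ V := by
    intro a
    refine Submodule.span_le.2 ?_
    rintro x ⟨s, hs, -, -, rfl⟩
    by_cases hirr : Irrational (combination d l s)
    · exact Submodule.subset_span (Set.mem_insert_of_mem _ ⟨s, ⟨hs, hirr⟩, rfl⟩)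
    · obtain ⟨q, hq⟩ : ∃ q : ℚ, (q : ℝ) = combination d l s := by
        unfold Irrational at hirr
        exact not_not.mp hirr
      rw [← hq, show ((q : ℚ) : ℝ) = q • (1 : ℝ) by simp]
      exact Submodule.smul_mem _ q (Submodule.subset_span (Set.mem_insert _ _))
  set M : ℕ := Module.finrank ℚ (Submodule.span ℚ V) with hM
  have hcpos : 0 < 1 + Real.log 2 := by have := Real.log_pos one_lt_two; linarith
  have hdpos : (0 : ℝ) < d := by exact_mod_cast (show 0 < d by omega)
  -- a large `a`
  set t : ℝ := (M + 2) * (1 + Real.log 2) / (1 - 1 / 20) with ht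
  set a : ℝ := max ((1 / 20 : ℝ) ^ (-12 / (1 / 20 : ℝ)) * d) (d * Real.exp t) with ha
  have htpos : 0 ≤ t := by rw [ht]; positivity
  have hda : (d : ℝ) ≤ a := by
    refine le_trans ?_ (le_max_right _ _)
    have : 1 ≤ Real.exp t := Real.one_le_exp htpos
    nlinarith
  have h := h17 (1 / 20) a d l (by norm_num) (by norm_num) hd hda (le_max_left _ _) hl
  have hle : count (1 / 20) (a / d) ≤ M :=
    (show count (1 / 20) (a / d) ≤ _ by exact_mod_cast h).trans (Submodule.finrank_mono (hsub a))
  -- but `count (1/20) (a/d) ≥ M + 2`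
  have hlog : t ≤ Real.log (a / d) := by
    have h1 : Real.exp t ≤ a / d := by
      rw [le_div_iff₀ hdpos, mul_comm]
      exact le_max_right _ _
    have := Real.log_le_log (Real.exp_pos _) h1
    rwa [Real.log_exp] at this
  have hge : M + 2 ≤ count (1 / 20) (a / d) := by
    unfold count
    refine Nat.le_floor ?_
    have h20 : (0 : ℝ) < 1 - 1 / 20 := by norm_num
    have : (1 - 1 / 20) / (1 + Real.log 2) * t = (M + 2 : ℝ) := by
      rw [ht]; field_simp
    push_cast
    rw [← this]
    exact mul_le_mul_of_nonneg_left hlog (div_nonneg h20.le hcpos.le)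
  omega

end Literature.NumberTheory.Irrationality.Fischler2017
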